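import Summits.AnomalousDissipation.AnomalousDissipation.Theorems.TaylorCertificatePair.Negative.Ceiling
import Literature.Analysis.FunctionSpaces.TorusSobolevSpaceProofs
import Literature.Analysis.FluidPDE.SteadyNavierStokesEnergy

/-!
# Negative knowledge for the crux `EnsembleCeiling` (stmt-AnomalousDissipation-14090), II:
# the orthogonal class — every force whose wavevectors are all orthogonal to all its amplitudes is fat

Crux `TaylorCertificates.EnsembleCeiling` (route `AnomalousDissipation/TaylorCertificates`, rank 4),
cdisprove seat `refuter-cdisprove-stmt-AnomalousDissipation-14090-0`. Part I (`SingleModeFat`, same directory) kills the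
conclusion of the crux for single-mode forces. This part extends the dead class to every real
trigonometric-polynomial force `f = ∑ₘ Re(e_{kₘ} zₘ)` of the ORTHOGONAL CLASS `kₘ' · zₘ = 0` for ALL
pairs `(m, m')` (frequencies in normal form: pairwise distinct and non-opposite). Geometrically these are
exactly the unidirectional forces `g(x·a, x·b) e` (`e ⊥ a, b`; any number of shells) and the
one-coordinate shear forces `(g₁(x·n), g₂(x·n))` with values `⊥ n`: multi-mode, multi-shell, but the
Stokes preimage `A⁻¹f` is a steady Euler flow, so the laminar state `(νA)⁻¹f` is an exact steady
Navier–Stokes state for every `ν` and its Dirac mass a stationary statistical solution (FMRT IV Def. 1.3,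
remark pp. 181–182; tree theorem `Torus.isStationaryStatisticalSolution_dirac_holds`) of energy
`A/ν²`, `A = ∑ₘ ½(4π²|kₘ|²)⁻²‖zₘ‖² > 0`.

* `inertial_modes_orthogonalClass` — the inertial term of an orthogonal-class mode sum vanishes against
  every smooth field (pair formula: every transversal product `(kₘ ± kₘ')·zₘ` is zero).
* `exists_fat_stationary_of_orthogonalClass` — the laminar Dirac mass, energy `A/ν²`.
* `not_ceiling_of_orthogonalClass` — the conclusion of `EnsembleCeiling` fails for every such force with
  some `zₘ ≠ 0`: a witness `f` of the crux must have a wavevector NOT orthogonal to some amplitude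
  ("multi-mode" is not enough; cf. the route's own caveat "non-Euler-steady gravest shell").
Nothing here asserts a Theses statement.
-/

noncomputable section

open MeasureTheory UnitAddTorus Matrix
open scoped InnerProductSpace ENNReal ComplexConjugate

namespace Summit.AnomalousDissipation.AnomalousDissipation.Theorems.EnsembleCeiling.Negative

open Literature.Analysis.FunctionSpaces Literature.Analysis.FluidPDE
open Summit.AnomalousDissipation.AnomalousDissipation.Theorems.TaylorCertificatePair.Negative

variable {n : ℕ} {k : Fin n → (Fin 3 → ℤ)} {z : Fin n → (EuclideanSpace ℂ (Fin 3))}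

/-- `dotc` is subtractive in the frequency. -/
theorem dotc_sub_left (a b : Fin 3 → ℤ) (w : (EuclideanSpace ℂ (Fin 3))) :
    ((fun j => (((a - b)) j : ℂ)) ⬝ᵥ (WithLp.ofLp (w))) =
      ((fun j => ((a) j : ℂ)) ⬝ᵥ (WithLp.ofLp (w))) - ((fun j => ((b) j : ℂ)) ⬝ᵥ (WithLp.ofLp (w))) := by
  rw [sub_eq_add_neg, dotc_add_left, dotc_neg_left, ← sub_eq_add_neg]

/-- **Orthogonal-class mode sums are steady Euler flows**: if every wavevector is orthogonal to every
amplitude, the inertial term `∫ (u ⊗ u) : ∇G` vanishes against every smooth field `G`. -/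
theorem inertial_modes_orthogonalClass
    (horth : ∀ m m', ((fun j => (((k m')) j : ℂ)) ⬝ᵥ (WithLp.ofLp ((z m)))) = 0)
    {G : (UnitAddTorus (Fin 3)) → (EuclideanSpace ℝ (Fin 3))} (hG : Torus.IsSmooth G) :
    ∫ x, ⟪Torus.fderiv G x ((∑ mm, Torus.realTrigPoly {k mm} (fun _ => z mm)) x),
        (∑ mm, Torus.realTrigPoly {k mm} (fun _ => z mm)) x⟫_ℝ = 0 := by
  rw [inertial_modes hG]
  refine Finset.sum_eq_zero fun m _ => Finset.sum_eq_zero fun m' _ => ?_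
  rw [dotc_add_left, horth m m, horth m m', add_zero, zero_mul, Complex.zero_im, mul_zero, zero_add,
    dotc_sub_left, horth m m', horth m m, sub_zero, map_zero, zero_mul, Complex.zero_im, mul_zero]

/-- **The laminar state of an orthogonal-class force carries a stationary statistical solution of
energy `A/ν²`.** Frequencies nonzero and in normal form (pairwise distinct, non-opposite), every
wavevector orthogonal to every amplitude: for every `ν > 0` the Dirac mass at
`u_ν = ∑ₘ (4π²|kₘ|²ν)⁻¹ Re(e_{kₘ} zₘ) = (νA)⁻¹f` is a stationary statistical solution of `NS_ν(f)`,
`f = ∑ₘ Re(e_{kₘ} zₘ)`, with integrable energy `∑ₘ ½((4π²|kₘ|²ν)⁻¹)²‖zₘ‖²`. -/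
theorem exists_fat_stationary_of_orthogonalClass (hk : ∀ m, k m ≠ 0)
    (horth : ∀ m m', ((fun j => (((k m')) j : ℂ)) ⬝ᵥ (WithLp.ofLp ((z m)))) = 0)
    (hres : ∀ m m', m ≠ m' → k m ≠ k m' ∧ k m ≠ -k m') {ν : ℝ} (hν : 0 < ν) :
    ∃ μ : Measure (Torus.energySpace (Fin 3)),
      Torus.IsStationaryStatisticalSolution ν (∑ mm, Torus.realTrigPoly {k mm} (fun _ => z mm)) μ ∧
      Integrable (fun v : (Torus.energySpace (Fin 3)) => ‖v‖ ^ 2) μ ∧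
      Torus.ensembleEnergy μ = ∑ m, 2⁻¹ * (((4 * Real.pi ^ 2 * Torus.freqNormSq (k m) * ν)⁻¹) ^ 2 * ‖z m‖ ^ 2) := by
  have hkpos : ∀ m, 0 < Torus.freqNormSq (k m) := fun m =>
    lt_of_lt_of_le one_pos (Torus.one_le_freqNormSq_of_ne_zero (hk m))
  -- laminar amplitudes
  set c : Fin n → ℝ := fun m => (4 * Real.pi ^ 2 * Torus.freqNormSq (k m) * ν)⁻¹ with hc
  have hcpos : ∀ m, 0 < c m := fun m => by
    have := hkpos m
    simp only [hc]
    exact inv_pos.2 (by positivity)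
  have hcν : ∀ m, ν * (4 * Real.pi ^ 2 * Torus.freqNormSq (k m)) * c m = 1 := fun m => by
    have := (hkpos m).ne'
    simp only [hc]
    field_simp
  set zu : Fin n → (EuclideanSpace ℂ (Fin 3)) := fun m => ((c m : ℂ) • z m) with hzu
  have horth' : ∀ m m', ((fun j => (((k m')) j : ℂ)) ⬝ᵥ (WithLp.ofLp ((zu m)))) = 0 := fun m m' => by
    simp only [hzu]
    rw [dotc_smul, horth m m', mul_zero]
  set uf : (UnitAddTorus (Fin 3)) → (EuclideanSpace ℝ (Fin 3)) := (∑ mm, Torus.realTrigPoly {k mm} (fun _ => zu mm)) with huf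
  have hsm : Torus.IsSmooth uf := isSmooth_modes k zu
  have hdf : Torus.IsDivFree uf := isDivFree_modes k zu fun m => horth' m m
  have hzm : Torus.HasZeroMean uf := hasZeroMean_modes k zu hk
  have hmem : MemLp uf 2 volume := hsm.memLp 2
  obtain ⟨u, hu⟩ : ∃ u : (Torus.energySpace (Fin 3)), (((u : (Torus.energySpace (Fin 3))) : (Lp (EuclideanSpace ℝ (Fin 3)) 2 (volume : Measure (UnitAddTorus (Fin 3))))) : ((UnitAddTorus (Fin 3)) → (EuclideanSpace ℝ (Fin 3)))) =ᵐ[volume] uf :=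
    ⟨⟨hmem.toLp uf, Torus.smoothSolenoidal_subset_energySpace ⟨uf, hsm, hdf, hzm, hmem.coeFn_toLp⟩⟩,
      hmem.coeFn_toLp⟩
  have hV : ((u : (Torus.energySpace (Fin 3))) : (Lp (EuclideanSpace ℝ (Fin 3)) 2 (volume : Measure (UnitAddTorus (Fin 3))))) ∈ Torus.energySpaceV (Fin 3) :=
    Torus.smoothSolenoidal_subset_energySpaceV_holds ⟨uf, hsm, hdf, hzm, hu⟩
  -- the laminar state is a steady weak solution: (f, w) + ν (u, Δw) = 0 termwise, no inertial term
  have hsteady : Torus.IsSteadyWeakSolution ν (∑ mm, Torus.realTrigPoly {k mm} (fun _ => z mm)) u := by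
    intro w hw _ _
    rw [nsGeneratorPairing_of_ae hu, huf, inertial_modes_orthogonalClass horth' hw, add_zero,
      integral_inner_modes_left hw.integrable, integral_inner_modes_laplacian hw, Finset.mul_sum,
      ← Finset.sum_add_distrib]
    refine Finset.sum_eq_zero fun m _ => ?_
    simp only [hzu]
    rw [inner_smul_left, Complex.conj_ofReal, inner_neg_right, inner_smul_right, Complex.re_ofReal_mul,
      Complex.neg_re, Complex.re_ofReal_mul]
    linear_combination (-(⟪z m, mFourierCoeff (EuclideanSpace.complexify ∘ w) (k m)⟫_ℂ).re) * hcν m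
  have hf2 : MemLp (∑ mm, Torus.realTrigPoly {k mm} (fun _ => z mm)) 2 volume := memLp_modes k z
  -- energy of the laminar state: Parseval in normal form
  have hfc : ∀ m, mFourierCoeff (EuclideanSpace.complexify ∘ uf) (k m) = (2 : ℂ)⁻¹ • zu m := by
    intro m
    rw [huf, fc_modes, Finset.sum_eq_single m]
    · have hne : k m ≠ -k m := by
        intro h
        apply hk m
        funext i
        have hi := congrFun h i
        simp only [Pi.neg_apply] at hi
        simp only [Pi.zero_apply]
        omega
      rw [fc_mode, if_pos rfl, if_neg hne, EuclideanSpace.conjVec_zero, add_zero]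
    · intro m' _ hm'
      obtain ⟨h1, h2⟩ := hres m m' (Ne.symm hm')
      rw [fc_mode, if_neg h1, if_neg h2, EuclideanSpace.conjVec_zero, add_zero, smul_zero]
    · intro h
      exact absurd (Finset.mem_univ m) h
  have henergy : ∫ x, ‖uf x‖ ^ 2 = ∑ m, 2⁻¹ * (c m ^ 2 * ‖z m‖ ^ 2) := by
    have h1 : ∫ x, ‖uf x‖ ^ 2 = ∫ x, ⟪uf x, uf x⟫_ℝ :=
      integral_congr_ae (ae_of_all _ fun x => (real_inner_self_eq_norm_sq _).symm)
    rw [h1, huf, integral_inner_modes_left hsm.integrable]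
    refine Finset.sum_congr rfl fun m _ => ?_
    rw [hfc m, inner_smul_right, show (2 : ℂ)⁻¹ = ((2⁻¹ : ℝ) : ℂ) by norm_num, Complex.re_ofReal_mul]
    simp only [hzu]
    have hzz : (⟪z m, z m⟫_ℂ).re = ‖z m‖ ^ 2 := by
      have := inner_self_eq_norm_sq (𝕜 := ℂ) (z m)
      simpa using this
    rw [inner_smul_left, inner_smul_right, Complex.conj_ofReal, Complex.re_ofReal_mul, Complex.re_ofReal_mul, hzz]
    ring
  haveI : MeasurableSingletonClass (Torus.energySpace (Fin 3)) := OpensMeasurableSpace.toMeasurableSingletonClass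
  refine ⟨Measure.dirac u, Torus.isStationaryStatisticalSolution_dirac_holds hν.le hf2 (by simp) hV hsteady,
    Torus.integrable_dirac u _, ?_⟩
  unfold Torus.ensembleEnergy
  rw [integral_dirac, norm_sq_of_ae hu, henergy]

/-- **No ensemble ceiling for an orthogonal-class force.** For `f = ∑ₘ Re(e_{kₘ} zₘ)` with nonzero
frequencies in normal form, all wavevectors orthogonal to all amplitudes and some `zₘ ≠ 0`, the
conclusion of `EnsembleCeiling` fails: at `ν = min(ν₀/2, 1, A/(|E|+1))` the laminar Dirac mass has
mean energy `A/ν² > E`. Covers every unidirectional trigonometric-polynomial force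
`g(x·a, x·b) e` (`e ⊥ a, b`) and every one-coordinate shear force — multi-mode, multi-shell
forces whose Stokes preimage is Euler-steady. -/
theorem not_ceiling_of_orthogonalClass (hk : ∀ m, k m ≠ 0)
    (horth : ∀ m m', ((fun j => (((k m')) j : ℂ)) ⬝ᵥ (WithLp.ofLp ((z m)))) = 0)
    (hres : ∀ m m', m ≠ m' → k m ≠ k m' ∧ k m ≠ -k m') (hz : ∃ m, z m ≠ 0) :
    ¬ ∃ (E ν₀ : ℝ), 0 < ν₀ ∧ ∀ ν : ℝ, 0 < ν → ν < ν₀ → ∀ μ : Measure (Torus.energySpace (Fin 3)),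
      Torus.IsStationaryStatisticalSolution ν (∑ mm, Torus.realTrigPoly {k mm} (fun _ => z mm)) μ →
        Integrable (fun v : (Torus.energySpace (Fin 3)) => ‖v‖ ^ 2) μ → Torus.ensembleEnergy μ ≤ E := by
  rintro ⟨E, ν₀, hν₀, h⟩
  have hkpos : ∀ m, 0 < Torus.freqNormSq (k m) := fun m =>
    lt_of_lt_of_le one_pos (Torus.one_le_freqNormSq_of_ne_zero (hk m))
  set A : ℝ := ∑ m, 2⁻¹ * (((4 * Real.pi ^ 2 * Torus.freqNormSq (k m))⁻¹) ^ 2 * ‖z m‖ ^ 2) with hA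
  have hApos : 0 < A := by
    obtain ⟨m₀, hm₀⟩ := hz
    have hzpos : 0 < ‖z m₀‖ := norm_pos_iff.2 hm₀
    have hterm : ∀ m ∈ (Finset.univ : Finset (Fin n)),
        0 ≤ 2⁻¹ * (((4 * Real.pi ^ 2 * Torus.freqNormSq (k m))⁻¹) ^ 2 * ‖z m‖ ^ 2) := fun m _ => by positivity
    have h0 : 0 < 2⁻¹ * (((4 * Real.pi ^ 2 * Torus.freqNormSq (k m₀))⁻¹) ^ 2 * ‖z m₀‖ ^ 2) := by
      have := hkpos m₀
      positivity
    exact lt_of_lt_of_le h0 (Finset.single_le_sum hterm (Finset.mem_univ m₀))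
  have hE1 : 0 < |E| + 1 := by positivity
  set ν : ℝ := min (ν₀ / 2) (min 1 (A / (|E| + 1))) with hνdef
  have hν : 0 < ν := lt_min (half_pos hν₀) (lt_min one_pos (div_pos hApos hE1))
  have hνν₀ : ν < ν₀ := (min_le_left _ _).trans_lt (half_lt_self hν₀)
  have hν1 : ν ≤ 1 := (min_le_right _ _).trans (min_le_left _ _)
  have hνA : ν ≤ A / (|E| + 1) := (min_le_right _ _).trans (min_le_right _ _)
  obtain ⟨μ, hμ, hint, hen⟩ := exists_fat_stationary_of_orthogonalClass hk horth hres hν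
  have hle := h ν hν hνν₀ μ hμ hint
  have hAν : ∑ m, 2⁻¹ * (((4 * Real.pi ^ 2 * Torus.freqNormSq (k m) * ν)⁻¹) ^ 2 * ‖z m‖ ^ 2) = A / ν ^ 2 := by
    rw [hA, Finset.sum_div]
    refine Finset.sum_congr rfl fun m _ => ?_
    have := hkpos m
    field_simp
  rw [hen, hAν, div_le_iff₀ (by positivity)] at hle
  have h1 : E * ν ^ 2 ≤ |E| * ν := by
    calc E * ν ^ 2 ≤ |E| * ν ^ 2 := mul_le_mul_of_nonneg_right (le_abs_self E) (sq_nonneg ν)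
      _ ≤ |E| * ν := mul_le_mul_of_nonneg_left (by nlinarith) (abs_nonneg E)
  have h2 : |E| * ν ≤ |E| * (A / (|E| + 1)) := mul_le_mul_of_nonneg_left hνA (abs_nonneg E)
  have h3 : |E| * (A / (|E| + 1)) < A := by
    rw [mul_div_assoc', div_lt_iff₀ hE1]
    nlinarith
  linarith

end Summit.AnomalousDissipation.AnomalousDissipation.Theorems.EnsembleCeiling.Negative
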